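import Summits.Ventures.PercRepro.Night2NonFatLoadedTwo
import Summits.Ventures.PercRepro.Night2FatXLine

/-!
# night-2: the LINE regime — a target with seven points on a line and six points off it is UNLOADED (gen 38)

A loaded target `T` of the cell `(2, 1)` is a good / missed target `Q_b ∪ {x}` or a distance-2 target `Q_b ∪ {x, x′}` of a
lossy big pair `(B_b, z_b)` (`exists_pair_of_dload_ne_zero'`), and `Q_b ∖ K` is three coloops plus a rank-`2` set `R` of
`|Q_b ∖ K| − 3` points (`exists_rank_two_of_loss_ne_zero`).  Hence **a loaded target contains a rank-`2` set of at least
`|T ∖ K| − 5` points** (`exists_rank_two_of_dload_ne_zero`).  For a line `ℓ = cl B₀`: if `R` has two points on `ℓ` it lies in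
`ℓ`, so `|T′ ∖ ℓ| ≤ 5`; otherwise `|R| ≤ 1 + |T′ ∖ ℓ|`, so `|T′ ∩ ℓ| ≤ 6`.  **A target with seven points of `T ∖ K` in `cl B₀`
and six points off it is unloaded** (`dload_eq_zero_of_seven_in_clF_six_off`).  For a basis pair `(B, z)` with two basis
points `a, b` and the line `ℓ = cl {a, b}`: every target `Q ∪ (Y_D ∪ Y_O)` with `Y_D ⊆ W ∩ ℓ`, `|Y_D| ≥ 5`, `Y_O ⊆ W ∖ ℓ`,
`|Y_O| ≥ 3` is unloaded (`dload_eq_zero_of_line_target`).  Paper: proofs/NIGHT-2-g38.md §1.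
-/

namespace PercRepro.Shadow

open PercRepro.ThmH PercRepro.PerFlat

variable {α : Type*} [DecidableEq α] {M : Matroid α} [M.Finite] {G : Finset α}

/-- **A loaded target contains a rank-`2` set of at least `|T ∖ K| − 5` points.** -/
theorem exists_rank_two_of_dload_ne_zero (hG : G ∈ flatsQ M (5 + 1)) (hd : (gr M \ G).card = 2)
    (hk : kColoops M G = 1) (hs : ∀ e ∈ gr M, ∀ f ∈ gr M, e ≠ f → rkN M {e, f} = 2)
    (hl : ∀ e ∈ gr M, M.Indep {e}) (hfat : (fatClosures M 5 G 2).card ≤ 1) {T : Finset α}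
    (hne : dload M 5 G (bigP M G) (dshGT2 M 5 G) T ≠ 0) :
    ∃ R ⊆ T \ coloops M G, rkN M R = 2 ∧ (T \ coloops M G).card ≤ R.card + 5 := by
  have hd' : (gr M \ G).card ≤ 5 := by omega
  obtain ⟨B, hB, hbig, z, hz, hloss, hcase⟩ := exists_pair_of_dload_ne_zero' hG hd hk hs hl hfat hne
  have hKB : coloops M G ⊆ B := coloops_subset_of_mem_thinMembers hG hd' hB
  obtain ⟨R, hRQ, hR2, hRcard⟩ := exists_rank_two_of_loss_ne_zero hG hd hk hs hl hB hbig hz hloss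
  rcases hcase with ⟨-, x, hx, rfl⟩ | ⟨-, p, hp, rfl⟩
  · have hxQ : x ∉ insert z B := notMem_of_mem_goodPts hx
    have hxK : x ∉ coloops M G := fun h => hxQ (Finset.mem_insert_of_mem (hKB h))
    refine ⟨R, hRQ.trans ?_, hR2, ?_⟩
    · rw [insert_sdiff_coloops_eq hxK]
      exact Finset.subset_insert _ _
    · rw [insert_sdiff_coloops_eq hxK,
        Finset.card_insert_of_notMem (fun h => hxQ (Finset.mem_sdiff.1 h).1)]
      omega
  · rw [mem_d2Pts] at hp
    obtain ⟨⟨hp1, hp2⟩, -, -⟩ := hp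
    have hp1Q : p.1 ∉ insert z B := (Finset.mem_sdiff.1 hp1).2
    have hp2Q : p.2 ∉ insert z B := (Finset.mem_sdiff.1 hp2).2
    have hp1K : p.1 ∉ coloops M G := fun h => hp1Q (Finset.mem_insert_of_mem (hKB h))
    have hp2K : p.2 ∉ coloops M G := fun h => hp2Q (Finset.mem_insert_of_mem (hKB h))
    refine ⟨R, hRQ.trans ?_, hR2, ?_⟩
    · rw [insert_sdiff_coloops_eq hp1K, insert_sdiff_coloops_eq hp2K]
      exact (Finset.subset_insert _ _).trans (Finset.subset_insert _ _)
    · rw [insert_sdiff_coloops_eq hp1K, insert_sdiff_coloops_eq hp2K]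
      have h1 := Finset.card_insert_le p.1 (insert p.2 (insert z B \ coloops M G))
      have h2 := Finset.card_insert_le p.2 (insert z B \ coloops M G)
      omega

/-- **A target with seven points of `T ∖ K` in the closure `cl B₀` and six points off it is unloaded**: a rank-`2` set
`R ⊆ T ∖ K` with `|R| ≥ |T ∖ K| − 5` either has two points in `cl B₀` (then `R ⊆ cl B₀`, so `|T′ ∖ cl B₀| ≤ 5`) or at most
one (then `|R| ≤ 1 + |T′ ∖ cl B₀|`, so `|T′ ∩ cl B₀| ≤ 6`). -/
theorem dload_eq_zero_of_seven_in_clF_six_off (hG : G ∈ flatsQ M (5 + 1)) (hd : (gr M \ G).card = 2)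
    (hk : kColoops M G = 1) (hs : ∀ e ∈ gr M, ∀ f ∈ gr M, e ≠ f → rkN M {e, f} = 2)
    (hl : ∀ e ∈ gr M, M.Indep {e}) (hfat : (fatClosures M 5 G 2).card ≤ 1) {T : Finset α} (hTG : T ⊆ G)
    (B₀ : Finset α) (h7 : 7 ≤ ((T \ coloops M G) ∩ clF M B₀).card)
    (h6 : 6 ≤ ((T \ coloops M G) \ clF M B₀).card) :
    dload M 5 G (bigP M G) (dshGT2 M 5 G) T = 0 := by
  by_contra hne
  obtain ⟨R, hRT, hR2, hcard⟩ := exists_rank_two_of_dload_ne_zero hG hd hk hs hl hfat hne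
  have hGg : G ⊆ gr M := (mem_flatsQ.1 hG).1
  have hRg : R ⊆ gr M := hRT.trans (Finset.sdiff_subset.trans (hTG.trans hGg))
  have hsplit := Finset.card_sdiff_add_card_inter (T \ coloops M G) (clF M B₀)
  have hRsplit := Finset.card_sdiff_add_card_inter R (clF M B₀)
  by_cases h2 : 2 ≤ (R ∩ clF M B₀).card
  · obtain ⟨r₁, hr₁, r₂, hr₂, hne12⟩ := Finset.one_lt_card.1 h2
    have hsub : R ⊆ clF M B₀ :=
      subset_clF_of_rkN_le_two_of_two_mem hs hRg hR2.le (Finset.mem_inter.1 hr₁).1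
        (Finset.mem_inter.1 hr₂).1 hne12 (Finset.mem_inter.1 hr₁).2 (Finset.mem_inter.1 hr₂).2
    have hRle : R.card ≤ ((T \ coloops M G) ∩ clF M B₀).card :=
      Finset.card_le_card (Finset.subset_inter hRT hsub)
    omega
  · have hRle : (R \ clF M B₀).card ≤ ((T \ coloops M G) \ clF M B₀).card :=
      Finset.card_le_card (Finset.sdiff_subset_sdiff hRT (Finset.Subset.refl _))
    omega

/-- The off-coloop part `Q′ = Q ∖ K` of a basis pair is independent of rank `5`. -/
theorem rkN_insert_sdiff_coloops_eq_five (hG : G ∈ flatsQ M (5 + 1)) (hd : (gr M \ G).card = 2)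
    (hk : kColoops M G = 1) {B : Finset α} (hB : B ∈ thinMembers M 5 G) (hnP : ¬ bigP M G B) {z : α}
    (hz : z ∈ G \ clF M B) :
    rkN M (insert z B \ coloops M G) = 5 ∧ (insert z B \ coloops M G).card = 5 := by
  have hd' : (gr M \ G).card ≤ 5 := by omega
  have h4 := card_sdiff_eq_four_of_not_bigP hG hd hk hB hnP
  have hKB : coloops M G ⊆ B := coloops_subset_of_mem_thinMembers hG hd' hB
  have hBG : B ⊆ G := subset_G_of_mem_thinMembers hB
  have hGg : G ⊆ gr M := (mem_flatsQ.1 hG).1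
  have hzB : z ∉ B := fun h => (Finset.mem_sdiff.1 hz).2 (subset_clF_of_subset_gr (hBG.trans hGg) h)
  have hzK : z ∉ coloops M G := fun h => hzB (hKB h)
  have hcard : (insert z B \ coloops M G).card = 5 := by
    rw [insert_sdiff_coloops_eq hzK, Finset.card_insert_of_notMem (fun h => hzB (Finset.mem_sdiff.1 h).1), h4]
  refine ⟨?_, hcard⟩
  have hind : M.Indep ((insert z B \ coloops M G : Finset α) : Set α) :=
    (indep_insert_of_basis_pair hG hd hk hB hnP hz).subset (by exact_mod_cast (Finset.sdiff_subset))
  rw [rkN_eq_card_of_indep hind, hcard]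

/-- An independent set has at most two points in the closure of a pair. -/
theorem card_inter_clF_pair_le_two_of_indep {S : Finset α} (hS : M.Indep (S : Set α)) {a b : α} :
    (S ∩ clF M {a, b}).card ≤ 2 := by
  have hind : M.Indep ((S ∩ clF M {a, b} : Finset α) : Set α) :=
    hS.subset (by exact_mod_cast (Finset.inter_subset_left))
  have h1 := rkN_eq_card_of_indep hind
  have h2 : rkN M (S ∩ clF M {a, b}) ≤ rkN M {a, b} :=
    rkN_le_of_subset_clF' (Finset.inter_subset_right)
  have h3 : rkN M {a, b} ≤ 2 := by
    refine le_trans (rkN_le_card _) ?_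
    exact Finset.card_le_two
  omega

/-- **Every target `Q ∪ (Y_D ∪ Y_O)` of the line regime is unloaded**: `a, b ∈ Q′` basis points, `ℓ = cl {a, b}`,
`Y_D ⊆ W ∩ ℓ` with `|Y_D| ≥ 5` and `Y_O ⊆ W ∖ ℓ` with `|Y_O| ≥ 3` (`T′ ∩ ℓ ⊇ {a, b} ∪ Y_D` has `≥ 7` points and
`T′ ∖ ℓ ⊇ (Q′ ∖ ℓ) ∪ Y_O` has `≥ 3 + 3` points). -/
theorem dload_eq_zero_of_line_target (hG : G ∈ flatsQ M (5 + 1)) (hd : (gr M \ G).card = 2)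
    (hk : kColoops M G = 1) (hs : ∀ e ∈ gr M, ∀ f ∈ gr M, e ≠ f → rkN M {e, f} = 2)
    (hl : ∀ e ∈ gr M, M.Indep {e}) (hfat : (fatClosures M 5 G 2).card ≤ 1) {B : Finset α}
    (hB : B ∈ thinMembers M 5 G) (hnP : ¬ bigP M G B) {z : α} (hz : z ∈ G \ clF M B) {a b : α}
    (ha : a ∈ insert z B \ coloops M G) (hb : b ∈ insert z B \ coloops M G) (hab : a ≠ b)
    {YD YO : Finset α} (hYD : YD ⊆ (G \ insert z B) ∩ clF M {a, b}) (h5 : 5 ≤ YD.card)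
    (hYO : YO ⊆ (G \ insert z B) \ clF M {a, b}) (h3 : 3 ≤ YO.card) :
    dload M 5 G (bigP M G) (dshGT2 M 5 G) (insert z B ∪ (YD ∪ YO)) = 0 := by
  have hd' : (gr M \ G).card ≤ 5 := by omega
  have hGg : G ⊆ gr M := (mem_flatsQ.1 hG).1
  have hBG : B ⊆ G := subset_G_of_mem_thinMembers hB
  have hQG : insert z B ⊆ G := Finset.insert_subset (Finset.mem_sdiff.1 hz).1 hBG
  have hTG : insert z B ∪ (YD ∪ YO) ⊆ G :=
    Finset.union_subset hQG (Finset.union_subset (hYD.trans (Finset.inter_subset_left.trans Finset.sdiff_subset))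
      (hYO.trans (Finset.sdiff_subset.trans Finset.sdiff_subset)))
  obtain ⟨hrk5, hcard5⟩ := rkN_insert_sdiff_coloops_eq_five hG hd hk hB hnP hz
  have hQ'g : insert z B \ coloops M G ⊆ gr M := Finset.sdiff_subset.trans (hQG.trans hGg)
  have hab_cl : ({a, b} : Finset α) ⊆ clF M {a, b} := by
    apply subset_clF_of_subset_gr
    intro x hx
    rw [Finset.mem_insert, Finset.mem_singleton] at hx
    rcases hx with rfl | rfl
    · exact hQ'g ha
    · exact hQ'g hb
  apply dload_eq_zero_of_seven_in_clF_six_off hG hd hk hs hl hfat hTG {a, b}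
  · -- seven points on the line: `{a, b} ∪ Y_D`
    have hsub : {a, b} ∪ YD ⊆ ((insert z B ∪ (YD ∪ YO)) \ coloops M G) ∩ clF M {a, b} := by
      intro x hx
      rw [Finset.mem_union] at hx
      rw [Finset.mem_inter, Finset.mem_sdiff, Finset.mem_union]
      rcases hx with hx | hx
      · refine ⟨⟨Or.inl ?_, ?_⟩, hab_cl hx⟩
        · rw [Finset.mem_insert, Finset.mem_singleton] at hx
          rcases hx with rfl | rfl
          · exact (Finset.mem_sdiff.1 ha).1
          · exact (Finset.mem_sdiff.1 hb).1
        · rw [Finset.mem_insert, Finset.mem_singleton] at hx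
          rcases hx with rfl | rfl
          · exact (Finset.mem_sdiff.1 ha).2
          · exact (Finset.mem_sdiff.1 hb).2
      · have hx' := hYD hx
        rw [Finset.mem_inter, Finset.mem_sdiff] at hx'
        refine ⟨⟨Or.inr (Finset.mem_union_left _ hx), ?_⟩, hx'.2⟩
        intro hxK
        exact hx'.1.2 (Finset.mem_insert_of_mem (coloops_subset_of_mem_thinMembers hG hd' hB hxK))
    have hdisj : Disjoint ({a, b} : Finset α) YD := by
      rw [Finset.disjoint_left]
      intro x hx hx'
      have hx'' := hYD hx'
      rw [Finset.mem_inter, Finset.mem_sdiff] at hx''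
      rw [Finset.mem_insert, Finset.mem_singleton] at hx
      rcases hx with rfl | rfl
      · exact hx''.1.2 (Finset.mem_sdiff.1 ha).1
      · exact hx''.1.2 (Finset.mem_sdiff.1 hb).1
    have hcard := Finset.card_le_card hsub
    rw [Finset.card_union_of_disjoint hdisj, Finset.card_pair hab] at hcard
    omega
  · -- six points off the line: `(Q′ ∖ ℓ) ∪ Y_O`
    have hsub : (insert z B \ coloops M G) \ clF M {a, b} ∪ YO ⊆
        ((insert z B ∪ (YD ∪ YO)) \ coloops M G) \ clF M {a, b} := by
      intro x hx
      rw [Finset.mem_union] at hx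
      rw [Finset.mem_sdiff, Finset.mem_sdiff, Finset.mem_union]
      rcases hx with hx | hx
      · rw [Finset.mem_sdiff, Finset.mem_sdiff] at hx
        exact ⟨⟨Or.inl hx.1.1, hx.1.2⟩, hx.2⟩
      · have hx' := hYO hx
        rw [Finset.mem_sdiff, Finset.mem_sdiff] at hx'
        refine ⟨⟨Or.inr (Finset.mem_union_right _ hx), ?_⟩, hx'.2⟩
        intro hxK
        exact hx'.1.2 (Finset.mem_insert_of_mem (coloops_subset_of_mem_thinMembers hG hd' hB hxK))
    have hdisj : Disjoint ((insert z B \ coloops M G) \ clF M {a, b}) YO := by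
      rw [Finset.disjoint_left]
      intro x hx hx'
      have hx'' := hYO hx'
      rw [Finset.mem_sdiff, Finset.mem_sdiff] at hx''
      rw [Finset.mem_sdiff, Finset.mem_sdiff] at hx
      exact hx''.1.2 hx.1.1
    have hind : M.Indep ((insert z B \ coloops M G : Finset α) : Set α) :=
      (indep_insert_of_basis_pair hG hd hk hB hnP hz).subset (by exact_mod_cast (Finset.sdiff_subset))
    have h2 := card_inter_clF_pair_le_two_of_indep hind (a := a) (b := b)
    have hsplit := Finset.card_sdiff_add_card_inter (insert z B \ coloops M G) (clF M {a, b})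
    have hcard := Finset.card_le_card hsub
    rw [Finset.card_union_of_disjoint hdisj] at hcard
    omega

end PercRepro.Shadow
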